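import Mathlib.CategoryTheory.Adjunction.Unique
import Literature.AnabelianGeometry.Anabelioids.Basic

/-!
# Finite étale morphisms of anabelioids: isomorphisms, composites ([GeoAn] §1.2, Def 1.2.2)

Mochizuki, *The geometry of anabelioids*, Publ. RIMS **40** (2004) 819–881, §1.2 p.17: a morphism of
anabelioids `φ : Y → X` is *finite étale* if it factors as an isomorphism `Y ⥲ X_S` followed by
`X_S → X` for an object `S` of `X` (`Anabelioids.IsFiniteEtale`: `φ^* ≅ Over.star S ⋙ α` with `α` an
equivalence). [cite: MochizukiGeoAn2004, Def. 1.2.2(i) p.17]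

PROOF-ONLY bookkeeping used silently throughout [SemiAnbd] §§2–4 (Def 2.2 (ii) "locally finite
étale", §4 "composites"; needed by the L3 bridge `SemiAnbdVocab.ofReal`, container laws
`isLocallyFiniteEtale_of_isLocallyTrivial`, `isLocallyFiniteEtale_comp`):

* `IsFiniteEtale.of_iso` — invariance under isomorphism of functors;
* `IsFiniteEtale.comp_isEquivalence` — post-composition with an equivalence;
* `isFiniteEtale_of_isEquivalence` — an isomorphism of anabelioids is finite étale (`S = ⊤`:
  `Over.star ⊤` is inverse to the equivalence `Over ⊤ ≌ X`, by uniqueness of right adjoints);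
* `IsFiniteEtale.comp` — composites of finite étale morphisms are finite étale: for
  `φ^* ≅ S^* ⋙ α`, `ψ^* ≅ T^* ⋙ β` one has `S^* ⋙ α ⋙ T^* ≅ (T'.left)^* ⋙ γ` with `T' := α⁻¹ T ∈ X_S`
  and `γ : X_{T'.left} ≌ (X_S)_{T'} ≌ Y_T` (iterated slices; both sides are right adjoint to the same
  forgetful functor, `Adjunction.rightAdjointUniq`).

Pure category theory over Mathlib's `Over.star` / `Over.forgetAdjStar` / `Over.iteratedSliceEquiv` /
`Over.postEquiv` / `Over.equivalenceOfIsTerminal`; no definition is introduced.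
-/

namespace Literature.AnabelianGeometry.Anabelioids

open CategoryTheory CategoryTheory.Limits

universe v₁ v₂ v₃ u₁ u₂ u₃

variable {X : Type u₁} [Category.{v₁} X] {Y : Type u₂} [Category.{v₂} Y] {Z : Type u₃}
  [Category.{v₃} Z]

/-- Finite étaleness is invariant under isomorphism of (pull-back) functors.
[cite: MochizukiGeoAn2004, Def. 1.2.2(i) p.17] -/
theorem IsFiniteEtale.of_iso [HasBinaryProducts X] {P P' : X ⥤ Y} (e : P ≅ P')
    (h : IsFiniteEtale P) : IsFiniteEtale P' := by
  obtain ⟨S, α, hα, ⟨i⟩⟩ := h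
  exact ⟨S, α, hα, ⟨e.symm ≪≫ i⟩⟩

/-- Finite étaleness is invariant under isomorphism of functors (iff form).
[cite: MochizukiGeoAn2004, Def. 1.2.2(i) p.17] -/
theorem isFiniteEtale_congr [HasBinaryProducts X] {P P' : X ⥤ Y} (e : P ≅ P') :
    IsFiniteEtale P ↔ IsFiniteEtale P' :=
  ⟨IsFiniteEtale.of_iso e, IsFiniteEtale.of_iso e.symm⟩

/-- A finite étale morphism followed (on pull-back functors: post-composed) by an isomorphism of
anabelioids is finite étale. [cite: MochizukiGeoAn2004, Def. 1.2.2(i) p.17] -/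
theorem IsFiniteEtale.comp_isEquivalence [HasBinaryProducts X] {P : X ⥤ Y} (h : IsFiniteEtale P)
    (E : Y ⥤ Z) [E.IsEquivalence] : IsFiniteEtale (P ⋙ E) := by
  obtain ⟨S, α, hα, ⟨i⟩⟩ := h
  haveI := hα
  exact ⟨S, α ⋙ E, inferInstance, ⟨Functor.isoWhiskerRight i E ≪≫ Functor.associator _ _ _⟩⟩

/-- **An isomorphism of anabelioids is finite étale** (`Y ⥲ X = X_⊤`).
[cite: MochizukiGeoAn2004, Def. 1.2.2(i) p.17] -/
theorem isFiniteEtale_of_isEquivalence [HasBinaryProducts X] [HasTerminal X] (P : X ⥤ Y)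
    [P.IsEquivalence] : IsFiniteEtale P := by
  let e : Over (⊤_ X) ≌ X := Over.equivalenceOfIsTerminal (X := ⊤_ X) terminalIsTerminal
  -- `Over.star ⊤` and `e.inverse` are both right adjoint to the forgetful functor `e.functor`
  let i : Over.star (⊤_ X) ≅ e.inverse :=
    Adjunction.rightAdjointUniq (Over.forgetAdjStar (⊤_ X)) e.toAdjunction
  refine ⟨⊤_ X, e.functor ⋙ P, inferInstance, ⟨?_⟩⟩
  exact P.leftUnitor.symm ≪≫
    Functor.isoWhiskerRight (e.counitIso.symm ≪≫ Functor.isoWhiskerRight i.symm _) P ≪≫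
      Functor.associator _ _ _

/-- The identity morphism of an anabelioid is finite étale. [cite: MochizukiGeoAn2004, Def. 1.2.2(i) p.17] -/
theorem isFiniteEtale_id [HasBinaryProducts X] [HasTerminal X] : IsFiniteEtale (𝟭 X) :=
  isFiniteEtale_of_isEquivalence _

/-- **Composites of finite étale morphisms are finite étale**: if `φ^* : X ⥤ Y` and `ψ^* : Y ⥤ Z`
are finite étale then so is `φ^* ⋙ ψ^* = (φ ∘ ψ)^*` (`Z ⥲ Y_T ⥲ (X_S)_{T'} ≌ X_{T'.left}`).
[cite: MochizukiGeoAn2004, Def. 1.2.2(i) p.17] -/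
theorem IsFiniteEtale.comp [HasBinaryProducts X] [HasBinaryProducts Y] {P : X ⥤ Y} {Q : Y ⥤ Z}
    (hP : IsFiniteEtale P) (hQ : IsFiniteEtale Q) : IsFiniteEtale (P ⋙ Q) := by
  obtain ⟨S, α, hα, ⟨i⟩⟩ := hP
  obtain ⟨T, β, hβ, ⟨j⟩⟩ := hQ
  haveI := hα
  haveI := hβ
  let eα : Over S ≌ Y := α.asEquivalence
  let E : Over T ≌ Over (eα.inverse.obj T).left :=
    (Over.postEquiv (X := T) eα.symm).trans (Over.iteratedSliceEquiv (eα.inverse.obj T))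
  -- `S^* ⋙ α ⋙ T^* ≅ (T'.left)^* ⋙ E⁻¹`: both sides are right adjoint to the forgetful `Y_T → X`
  let k : Over.star S ⋙ (eα.functor ⋙ Over.star T) ≅
      Over.star (eα.inverse.obj T).left ⋙ E.inverse :=
    Adjunction.rightAdjointUniq
      (((Over.forgetAdjStar T).comp eα.symm.toAdjunction).comp (Over.forgetAdjStar S))
      (E.toAdjunction.comp (Over.forgetAdjStar (eα.inverse.obj T).left))
  refine ⟨(eα.inverse.obj T).left, E.inverse ⋙ β, inferInstance, ⟨?_⟩⟩
  exact Functor.isoWhiskerRight i Q ≪≫ Functor.isoWhiskerLeft _ j ≪≫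
    Functor.associator _ _ _ ≪≫
    Functor.isoWhiskerLeft (Over.star S) (Functor.associator α (Over.star T) β).symm ≪≫
    (Functor.associator _ _ _).symm ≪≫
    Functor.isoWhiskerRight k β ≪≫ Functor.associator _ _ _

/-- Composites with an isomorphism of anabelioids in front (pre-composition of pull-back functors
with an equivalence) are finite étale. [cite: MochizukiGeoAn2004, Def. 1.2.2(i) p.17] -/
theorem IsFiniteEtale.isEquivalence_comp [HasBinaryProducts X] [HasTerminal X]
    [HasBinaryProducts Y] (E : X ⥤ Y) [E.IsEquivalence] {Q : Y ⥤ Z} (h : IsFiniteEtale Q) :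
    IsFiniteEtale (E ⋙ Q) :=
  (isFiniteEtale_of_isEquivalence E).comp h

end Literature.AnabelianGeometry.Anabelioids
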